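import Literature.Probability.RandomPlanarGeometry.StarHullOneStepCompensated
import Literature.Probability.RandomPlanarGeometry.SLERestrictionOneStep
import HarnessLib

/-!
# [LSW] Prop. 5.3 for `0 < κ ≤ 8/3`: the one-step conditional drift of `Y = h_t′(W_t)^α exp(−λ ∫ m)` is `o(h)`

General-`κ` twin of `SLERestrictionOneStep` ([LSW] Prop. 5.2/5.3 at `κ = 8/3`), after

* G. F. Lawler, O. Schramm, W. Werner, *Conformal restriction: the chordal case*, J. Amer. Math.
  Soc. **16** (2003) 917–955, arXiv:math/0209343 (**[LSW]**), §5 (5.2) `α = (6 − κ)/(2κ)`,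
  (5.3) `λ = (8 − 3κ)(6 − κ)/(2κ)`, Prop. 5.3: "`Y_t = h_t′(W_t)^α exp(λ ∫₀ᵗ Sh_s(W_s)/6 ds)`,
  `t < T`, is a local martingale. If `κ ≤ 8/3`, then `Y_t` is a bounded martingale (in fact,
  `0 ≤ Y_t ≤ 1`)."

Fix a `*`-hull `B₀` of the controlled class (`δ₀ ≤ Φ′_{B₀}(0)`, `B₀` off `B(0, 8ρ₀)`, `ρ₀ ≤ 1`)
and let it flow for a short time `h` under the SLE_κ driving function `U = √κ B` (`stepDriverK`;
`0 < κ ≤ 8/3`). With `d = Φ′_{B₀}(0)`, `m = m(B₀) = −SE_{B₀}(0)/6` (`bubbleMass d (c₂/2) (c₃/6)`,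
`StarHullOneStepMass`) and the compensator increment `J = ∫₀ʰ m(B_s) ds` of the step (any real
number `J` with `0 ≤ J ≤ h M_m` and `|J − h m| ≤ h · massStepC (h + η)`, which is what the mass
modulus of `StarHullOneStepMass` gives pathwise), we PROVE, for every measurable `Z : Ω → [0, 1]`
agreeing with `Φ′_{B′}(0)^α e^{−λJ}` on the good event `{σ sup_{[0,h]} |B| ≤ c₀}` (the same
event as at `κ = 8/3`, `goodEvent`),

  `|E[Z] − d^α| ≤ stepCK α λ δ₀ ρ₀ · h √h`     (`abs_integral_sub_le_of_eqOn_goodK`)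

from: the compensated deterministic expansion (`Loewner.abs_compensatedStep_le`,
`StarHullOneStepCompensated`) on the good event; the mean of the model
`stepModelK α d c₂ c₃ h x − λ h m d^α` over the increment `x = √κ B_h` (`E x = 0`, `E x² = κ h`),
`h (drift of (5.3) − λ m d^α)`, which VANISHES for `α = α_κ`, `λ = λ_κ` — [LSW] Prop. 5.3, here
the identity `driftK_eq_of_exponents` (PROVED) and `integral_compModelK_eq_zero`; and the good/bad
integral estimates of `SLERestrictionOneStep`, transported by scaling
(`setIntegral_good_le_of_le`, `setIntegral_bad_le_of_le`; `|√κ B| ≤ σ|B|` for `κ ≤ 8/3`).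

## References

* [LSW] §5 (5.2)–(5.3), Prop. 5.3. [LawlerSchrammWerner2003Restriction]
-/

noncomputable section

open Set Filter Metric Function MeasureTheory
open _root_.Complex _root_.Topology _root_.Real
open UpperHalfPlane (upperHalfPlaneSet)
open scoped NNReal ENNReal

namespace Literature.Probability.RandomPlanarGeometry

open Literature.Probability.Process Loewner

/-! ### The increment driver `U = √κ B` -/

/-- The SLE_κ driving function as the increment driver of one step. [folklore] -/
abbrev stepDriverK (κ : ℝ≥0) (ω : ℝ≥0 → ℝ) : ℝ≥0 → ℝ := sleDriving κ ω

/-- `U_r = √κ B_r`. [folklore] -/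
theorem stepDriverK_apply (κ : ℝ≥0) (ω : ℝ≥0 → ℝ) (r : ℝ≥0) :
    stepDriverK κ ω r = Real.sqrt κ * brownian r ω := rfl

/-- The driver is continuous and starts at `0`. [folklore] -/
theorem continuous_stepDriverK (κ : ℝ≥0) (ω : ℝ≥0 → ℝ) : Continuous (stepDriverK κ ω) ∧ stepDriverK κ ω 0 = 0 :=
  ⟨continuous_sleDriving _ ω, sleDriving_zero _ ω⟩

/-- `√κ ≤ σ = √(8/3)` for `κ ≤ 8/3`. [folklore] -/
theorem sqrt_le_stepSigma {κ : ℝ≥0} (hκ : κ ≤ 8 / 3) : Real.sqrt κ ≤ stepSigma := by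
  rw [stepSigma]
  exact Real.sqrt_le_sqrt (by exact_mod_cast hκ)

/-- `|√κ B_r| ≤ |σ B_r|` for `κ ≤ 8/3`. [folklore] -/
theorem abs_stepDriverK_le_abs_stepDriver {κ : ℝ≥0} (hκ : κ ≤ 8 / 3) (ω : ℝ≥0 → ℝ) (r : ℝ≥0) :
    |stepDriverK κ ω r| ≤ |stepDriver ω r| := by
  rw [stepDriverK_apply, stepDriver_apply, abs_mul, abs_mul, abs_of_nonneg (Real.sqrt_nonneg _),
    abs_of_pos stepSigma_pos]
  exact mul_le_mul_of_nonneg_right (sqrt_le_stepSigma hκ) (abs_nonneg _)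

/-- The oscillation bound `S = σ · runSup h`: `|U_r| ≤ S` for `r ≤ h`, `κ ≤ 8/3`. [folklore] -/
theorem abs_stepDriverK_le {κ : ℝ≥0} (hκ : κ ≤ 8 / 3) {h r : ℝ≥0} (hr : r ≤ h) (ω : ℝ≥0 → ℝ) :
    |stepDriverK κ ω r| ≤ stepSigma * runSup h ω :=
  (abs_stepDriverK_le_abs_stepDriver hκ ω r).trans (abs_stepDriver_le hr ω)

/-- `E[x] = 0`, `E[x²] = κ h` for `x = U_h = √κ B_h`, and integrability of `x`, `x²`. [folklore] -/
theorem integral_stepDriverK (κ : ℝ≥0) (h : ℝ≥0) :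
    (∫ ω, stepDriverK κ ω h ∂preWienerMeasure = 0) ∧
    (∫ ω, stepDriverK κ ω h ^ 2 ∂preWienerMeasure = κ * h) ∧
    Integrable (fun ω ↦ stepDriverK κ ω h) preWienerMeasure ∧
    Integrable (fun ω ↦ stepDriverK κ ω h ^ 2) preWienerMeasure := by
  have hfun : (fun ω ↦ stepDriverK κ ω h) = fun ω ↦ Real.sqrt κ * brownian h ω := funext fun ω ↦ stepDriverK_apply κ ω h
  refine ⟨?_, ?_, ?_, ?_⟩
  · rw [hfun, integral_const_mul, integral_brownian_eq_zero, mul_zero]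
  · simp_rw [stepDriverK_apply, mul_pow]
    rw [integral_const_mul, integral_brownian_sq, Real.sq_sqrt (NNReal.coe_nonneg κ)]
  · rw [hfun]; exact (integrable_brownian_pow h 1).const_mul (Real.sqrt κ) |>.congr (Eventually.of_forall fun ω ↦ by simp)
  · simp_rw [stepDriverK_apply, mul_pow]; exact (integrable_brownian_pow h 2).const_mul _

/-! ### [LSW] Prop. 5.3: the drift of (5.3) is compensated, and the model has mean zero -/

/-- **The identity behind [LSW] Prop. 5.3**: for `κ > 0`, `d > 0`, `α = (6 − κ)/(2κ)` and
`λ = (8 − 3κ)(6 − κ)/(2κ)`, the drift of `d^α` per unit time under the one-step expansion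
(`stepModelK_eq`) equals `λ · m · d^α` with `m = c₂²/(4d²) − c₃/(6d) = bubbleMass d (c₂/2) (c₃/6)`
(`= −SE(0)/6`); the two coefficient identities are `α(κ/2 − 4/3) = −λ/6` and
`α/2 + α(α−1)κ/2 = λ/4`. [cite: LawlerSchrammWerner2003Restriction, Prop. 5.3 with (5.2)–(5.3)] -/
theorem driftK_eq_of_exponents {κ α lam d : ℝ} (hκ : 0 < κ) (hd : 0 < d) (hα : α = (6 - κ) / (2 * κ))
    (hlam : lam = (8 - 3 * κ) * (6 - κ) / (2 * κ)) (c₂ c₃ : ℝ) :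
    α * d ^ (α - 1) * (κ / 2 * c₃ + c₂ ^ 2 / (2 * d) - 4 / 3 * c₃) + 1 / 2 * (α * (α - 1) * d ^ (α - 2)) * κ * c₂ ^ 2 =
      lam * bubbleMass d (c₂ / 2) (c₃ / 6) * d ^ α := by
  unfold bubbleMass
  have h1 : d ^ (α - 1) = d ^ α / d := Real.rpow_sub_one hd.ne' α
  have h2 : d ^ (α - 2) = d ^ α / d ^ 2 := by rw [Real.rpow_sub hd, Real.rpow_two]
  rw [h1, h2, hlam]
  subst hα
  field_simp
  ring

/-- **The compensated model has mean zero over a Brownian increment** (`E x = 0`, `E x² = κ h`):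
`E[stepModelK α d c₂ c₃ h x − λ h m d^α] = h (drift − λ m d^α) = 0`, with integrability.
[cite: LawlerSchrammWerner2003Restriction, Prop. 5.3] -/
theorem integral_compModelK_eq_zero {κ : ℝ≥0} {α lam d : ℝ} (hκ : 0 < κ) (hd : 0 < d)
    (hα : α = (6 - κ) / (2 * κ)) (hlam : lam = (8 - 3 * κ) * (6 - κ) / (2 * κ)) (c₂ c₃ : ℝ) (h : ℝ≥0) :
    ∫ ω, (stepModelK α d c₂ c₃ h (stepDriverK κ ω h) - lam * h * bubbleMass d (c₂ / 2) (c₃ / 6) * d ^ α)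
        ∂preWienerMeasure = 0 ∧
      Integrable (fun ω ↦ stepModelK α d c₂ c₃ h (stepDriverK κ ω h) -
        lam * h * bubbleMass d (c₂ / 2) (c₃ / 6) * d ^ α) preWienerMeasure := by
  haveI := isProbabilityMeasure_preWienerMeasure'
  obtain ⟨h1, h2, i1, i2⟩ := integral_stepDriverK κ h
  have hκ' : (0 : ℝ) < κ := by exact_mod_cast hκ
  have hdrift := driftK_eq_of_exponents hκ' hd hα hlam c₂ c₃
  have hfun : (fun ω ↦ stepModelK α d c₂ c₃ h (stepDriverK κ ω h) - lam * h * bubbleMass d (c₂ / 2) (c₃ / 6) * d ^ α) =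
      fun ω ↦ α * d ^ (α - 1) * c₂ * stepDriverK κ ω h +
        (α * d ^ (α - 1) * (c₃ / 2) + 1 / 2 * (α * (α - 1) * d ^ (α - 2)) * c₂ ^ 2) *
          (stepDriverK κ ω h ^ 2 - κ * h) := by
    funext ω
    rw [stepModelK_eq _ _ _ _ _ _ (κ : ℝ)]
    have key : (h : ℝ) * (α * d ^ (α - 1) * (κ / 2 * c₃ + c₂ ^ 2 / (2 * d) - 4 / 3 * c₃) +
        1 / 2 * (α * (α - 1) * d ^ (α - 2)) * κ * c₂ ^ 2) - lam * h * bubbleMass d (c₂ / 2) (c₃ / 6) * d ^ α = 0 := by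
      rw [hdrift]; ring
    linear_combination key
  have iA : Integrable (fun ω ↦ α * d ^ (α - 1) * c₂ * stepDriverK κ ω h) preWienerMeasure := i1.const_mul _
  have iB : Integrable (fun ω ↦ (α * d ^ (α - 1) * (c₃ / 2) + 1 / 2 * (α * (α - 1) * d ^ (α - 2)) * c₂ ^ 2) *
      (stepDriverK κ ω h ^ 2 - κ * h)) preWienerMeasure := (i2.sub (integrable_const _)).const_mul _
  refine ⟨?_, by rw [hfun]; exact iA.add iB⟩
  rw [hfun, integral_add iA iB, integral_const_mul, h1, integral_const_mul, integral_sub i2 (integrable_const _), h2,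
    integral_const]
  simp

/-! ### The integral estimates of `SLERestrictionOneStep`, transported by scaling -/

/-- The constant of the bad-event integral of `SLERestrictionOneStep` (`stepC = 25 K_clean + stepBadC`).
[folklore] -/
def stepBadC (δ₀ ρ₀ : ℝ) : ℝ :=
  2048 / (δ₀ * ρ₀ / 4000) ^ 4 * (1 + 3 * stepA2 δ₀ ρ₀) +
    2 * stepA1 δ₀ ρ₀ * Real.sqrt (2048 / (δ₀ * ρ₀ / 4000) ^ 4) +
    5 * stepA2 δ₀ ρ₀ * Real.sqrt (2048 / (δ₀ * ρ₀ / 4000) ^ 4)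

section Scaling

variable {B₀ : Set ℂ} {ρ₀ δ₀ : ℝ} {h : ℝ≥0}
variable (hB : IsStarHull B₀) (hρ₀ : 0 < ρ₀) (hρ1 : ρ₀ ≤ 1) (hBρ : Disjoint (ball (0 : ℂ) (8 * ρ₀)) B₀)
  (hδ0 : 0 < δ₀) (hδ : δ₀ ≤ starDeriv B₀) (hh0 : 0 < h) (hh : (h : ℝ) ≤ (δ₀ * ρ₀ / 4000) ^ 2 / 32)

include hB hρ₀ hρ1 hδ0 hδ hh in
/-- **The good-event integral with any constant**: if `|F′| ≤ K · (h η + h² + |x|³ + h |x|)` on the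
good event (`x = σ B_h`, `η = stepSize (σ runSup h)`), then `∫_G |F′| ≤ 25 K h √h`
(`setIntegral_good_le'` applied to `(K_clean/K) F′`). [folklore] -/
theorem setIntegral_good_le_of_le {F' : (ℝ≥0 → ℝ) → ℝ} {K : ℝ} (hK : 0 < K) (iF : Integrable F' preWienerMeasure)
    (hgood : ∀ ω ∈ goodEvent δ₀ ρ₀ h, |F' ω| ≤ K *
        (h * stepSize (stepSigma * runSup h ω) h + h ^ 2 + |stepDriver ω h| ^ 3 + h * |stepDriver ω h|)) :
    ∫ ω in goodEvent δ₀ ρ₀ h, |F' ω| ∂preWienerMeasure ≤ 25 * K * h * Real.sqrt h := by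
  obtain ⟨hd0, hd1, -⟩ := starDeriv_spec hB
  set Kc := stepKcleanOf δ₀ (stepK δ₀ ρ₀) with hKc
  have hKc0 : 0 < Kc := by
    rw [hKc, stepKcleanOf]
    have := (stepK_spec hδ0 (hδ.trans hd1) hρ₀ hρ1).1
    have h1 : 0 < (δ₀ / 2) ^ (-(19 / 8 : ℝ)) := Real.rpow_pos_of_pos (by positivity) _
    have h2 : 0 < δ₀ ^ (-(3 / 8 : ℝ)) := Real.rpow_pos_of_pos hδ0 _
    have h3 : 0 < δ₀ ^ (-(11 / 8 : ℝ)) := Real.rpow_pos_of_pos hδ0 _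
    positivity
  set G : (ℝ≥0 → ℝ) → ℝ := fun ω ↦ Kc / K * F' ω with hG
  have iG : Integrable G preWienerMeasure := iF.const_mul _
  have hgoodG : ∀ ω ∈ goodEvent δ₀ ρ₀ h, |G ω| ≤ Kc *
      (h * stepSize (stepSigma * runSup h ω) h + h ^ 2 + |stepDriver ω h| ^ 3 + h * |stepDriver ω h|) := by
    intro ω hω
    rw [hG]; dsimp only
    rw [abs_mul, abs_of_pos (div_pos hKc0 hK)]
    calc Kc / K * |F' ω| ≤ Kc / K * (K * (h * stepSize (stepSigma * runSup h ω) h + h ^ 2 + |stepDriver ω h| ^ 3 +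
          h * |stepDriver ω h|)) := mul_le_mul_of_nonneg_left (hgood ω hω) (by positivity)
      _ = _ := by field_simp
  have hGint := setIntegral_good_le' hB hρ₀ hρ1 hδ0 hδ hh iG hgoodG
  have heq : ∫ ω in goodEvent δ₀ ρ₀ h, |F' ω| ∂preWienerMeasure = K / Kc * ∫ ω in goodEvent δ₀ ρ₀ h, |G ω| ∂preWienerMeasure := by
    rw [← integral_const_mul]
    congr 1
    funext ω
    rw [hG]; dsimp only
    rw [abs_mul, abs_of_pos (div_pos hKc0 hK)]
    field_simp
  rw [heq]
  calc K / Kc * ∫ ω in goodEvent δ₀ ρ₀ h, |G ω| ∂preWienerMeasure ≤ K / Kc * (25 * Kc * h * Real.sqrt h) :=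
        mul_le_mul_of_nonneg_left hGint (by positivity)
    _ = 25 * K * h * Real.sqrt h := by field_simp

include hB hρ₀ hρ1 hδ0 hδ hh0 hh in
/-- **The bad-event integral with any constants**: if `|F′| ≤ 1 + A₁′ |x| + A₂′ (x² + (8/3) h)`
everywhere (`x = σ B_h`), then `∫_{Gᶜ} |F′| ≤ L · stepBadC · h √h` with
`L = max 1 (max (A₁′/A₁) (A₂′/A₂))` (`setIntegral_bad_le'` applied to `F′/L`). [folklore] -/
theorem setIntegral_bad_le_of_le {F' : (ℝ≥0 → ℝ) → ℝ} {A₁' A₂' : ℝ} (iF : Integrable F' preWienerMeasure)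
    (hbad : ∀ ω, |F' ω| ≤ 1 + A₁' * |stepDriver ω h| + A₂' * (stepDriver ω h ^ 2 + 8 / 3 * h)) :
    ∫ ω in (goodEvent δ₀ ρ₀ h)ᶜ, |F' ω| ∂preWienerMeasure ≤
      max 1 (max (A₁' / stepA1 δ₀ ρ₀) (A₂' / stepA2 δ₀ ρ₀)) * stepBadC δ₀ ρ₀ * h * Real.sqrt h := by
  have hS1 : 0 < stepA1 δ₀ ρ₀ := by
    rw [stepA1]; have := Real.rpow_pos_of_pos hδ0 (-(3 / 8 : ℝ)); positivity
  have hS2 : 0 < stepA2 δ₀ ρ₀ := by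
    rw [stepA2]
    have := Real.rpow_pos_of_pos hδ0 (-(3 / 8 : ℝ)); have := Real.rpow_pos_of_pos hδ0 (-(11 / 8 : ℝ)); positivity
  set L : ℝ := max 1 (max (A₁' / stepA1 δ₀ ρ₀) (A₂' / stepA2 δ₀ ρ₀)) with hL
  have hL1 : 1 ≤ L := le_max_left _ _
  have hL0 : 0 < L := by linarith
  have hA1L : A₁' ≤ L * stepA1 δ₀ ρ₀ := by
    have : A₁' / stepA1 δ₀ ρ₀ ≤ L := (le_max_left _ _).trans (le_max_right _ _)
    rwa [div_le_iff₀ hS1] at this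
  have hA2L : A₂' ≤ L * stepA2 δ₀ ρ₀ := by
    have : A₂' / stepA2 δ₀ ρ₀ ≤ L := (le_max_right _ _).trans (le_max_right _ _)
    rwa [div_le_iff₀ hS2] at this
  set G : (ℝ≥0 → ℝ) → ℝ := fun ω ↦ F' ω / L with hG
  have iG : Integrable G preWienerMeasure := iF.div_const _
  have hbadG : ∀ ω, |G ω| ≤ 1 + stepA1 δ₀ ρ₀ * |stepDriver ω h| + stepA2 δ₀ ρ₀ * (stepDriver ω h ^ 2 + 8 / 3 * h) := by
    intro ω
    rw [hG]; dsimp only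
    rw [abs_div, abs_of_pos hL0, div_le_iff₀ hL0]
    have hx0 : 0 ≤ |stepDriver ω h| := abs_nonneg _
    have hq0 : 0 ≤ stepDriver ω h ^ 2 + 8 / 3 * h := by positivity
    calc |F' ω| ≤ 1 + A₁' * |stepDriver ω h| + A₂' * (stepDriver ω h ^ 2 + 8 / 3 * h) := hbad ω
      _ ≤ L * 1 + (L * stepA1 δ₀ ρ₀) * |stepDriver ω h| + (L * stepA2 δ₀ ρ₀) * (stepDriver ω h ^ 2 + 8 / 3 * h) := by
          have e1 := mul_le_mul_of_nonneg_right hA1L hx0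
          have e2 := mul_le_mul_of_nonneg_right hA2L hq0
          linarith
      _ = (1 + stepA1 δ₀ ρ₀ * |stepDriver ω h| + stepA2 δ₀ ρ₀ * (stepDriver ω h ^ 2 + 8 / 3 * h)) * L := by ring
  have hGint := setIntegral_bad_le' hB hρ₀ hρ1 hδ0 hδ hh0 hh iG hbadG
  have heq : ∫ ω in (goodEvent δ₀ ρ₀ h)ᶜ, |F' ω| ∂preWienerMeasure = L * ∫ ω in (goodEvent δ₀ ρ₀ h)ᶜ, |G ω| ∂preWienerMeasure := by
    rw [← integral_const_mul]
    congr 1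
    funext ω
    rw [hG]; dsimp only
    rw [abs_div, abs_of_pos hL0]
    field_simp
  rw [heq, show stepBadC δ₀ ρ₀ = 2048 / (δ₀ * ρ₀ / 4000) ^ 4 * (1 + 3 * stepA2 δ₀ ρ₀) +
    2 * stepA1 δ₀ ρ₀ * Real.sqrt (2048 / (δ₀ * ρ₀ / 4000) ^ 4) +
    5 * stepA2 δ₀ ρ₀ * Real.sqrt (2048 / (δ₀ * ρ₀ / 4000) ^ 4) from rfl]
  calc L * ∫ ω in (goodEvent δ₀ ρ₀ h)ᶜ, |G ω| ∂preWienerMeasure ≤ L * ((2048 / (δ₀ * ρ₀ / 4000) ^ 4 * (1 + 3 * stepA2 δ₀ ρ₀) +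
        2 * stepA1 δ₀ ρ₀ * Real.sqrt (2048 / (δ₀ * ρ₀ / 4000) ^ 4) +
        5 * stepA2 δ₀ ρ₀ * Real.sqrt (2048 / (δ₀ * ρ₀ / 4000) ^ 4)) * h * Real.sqrt h) :=
        mul_le_mul_of_nonneg_left hGint hL0.le
    _ = _ := by ring

end Scaling

/-! ### The one-step bound for `0 < κ ≤ 8/3`, abstract version -/

/-- **The constant of the one-step estimate for exponent `α` and compensator rate `λ`.**
[folklore] -/
def stepCK (α lam δ₀ ρ₀ : ℝ) : ℝ :=
  25 * compK α lam δ₀ ρ₀ +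
    max 1 (max (modelKA1 α δ₀ ρ₀ / stepA1 δ₀ ρ₀) ((modelKA2 α δ₀ ρ₀ + 3 / 8 * (lam * massBound δ₀ ρ₀)) / stepA2 δ₀ ρ₀)) *
      stepBadC δ₀ ρ₀

/-- `0 < compK` for `α > 0`, `λ ≥ 0`. [folklore] -/
theorem compK_pos {α lam δ₀ ρ₀ : ℝ} (hα : 0 < α) (hlam : 0 ≤ lam) (hδ0 : 0 < δ₀) (hρ₀ : 0 < ρ₀) :
    0 < compK α lam δ₀ ρ₀ := by
  rw [compK]
  have hrK : 0 < ratioK α δ₀ := by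
    rw [ratioK]
    have n1 : 0 ≤ |α * (α - 1) * (α - 2)| * (1 + (3 : ℝ) ^ (α - 3)) * ((δ₀ / 2) ^ (α - 5 / 8) + 1) := by
      have := Real.rpow_nonneg (by norm_num : (0 : ℝ) ≤ 3) (α - 3)
      have := Real.rpow_nonneg (by positivity : (0 : ℝ) ≤ δ₀ / 2) (α - 5 / 8)
      positivity
    have n2 : 0 < (8 * α / 5 + 64 * |α * (α - 1)| / 15) * (δ₀ ^ (α - 5 / 8) + 1) := by
      have := Real.rpow_nonneg hδ0.le (α - 5 / 8)
      have : 0 < 8 * α / 5 := by positivity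
      positivity
    linarith
  have hKc : 0 < stepKcleanOf δ₀ (stepK δ₀ ρ₀) := by
    rw [stepKcleanOf]
    have : 0 < stepK δ₀ ρ₀ := by rw [stepK]; positivity
    have h1 : 0 < (δ₀ / 2) ^ (-(19 / 8 : ℝ)) := Real.rpow_pos_of_pos (by positivity) _
    have h2 : 0 < δ₀ ^ (-(3 / 8 : ℝ)) := Real.rpow_pos_of_pos hδ0 _
    have h3 : 0 < δ₀ ^ (-(11 / 8 : ℝ)) := Real.rpow_pos_of_pos hδ0 _
    positivity
  have := modelKP_nonneg hα.le hδ0 hρ₀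
  have := massStepC_nonneg hδ0 hρ₀
  have hM : 0 ≤ massBound δ₀ ρ₀ := by rw [massBound]; positivity
  have : 0 < ratioK α δ₀ * stepKcleanOf δ₀ (stepK δ₀ ρ₀) := mul_pos hrK hKc
  positivity

/-- `0 ≤ stepCK`. [folklore] -/
theorem stepCK_nonneg {α lam δ₀ ρ₀ : ℝ} (hα : 0 < α) (hlam : 0 ≤ lam) (hδ0 : 0 < δ₀) (hρ₀ : 0 < ρ₀) :
    0 ≤ stepCK α lam δ₀ ρ₀ := by
  have h1 : 0 ≤ compK α lam δ₀ ρ₀ := (compK_pos hα hlam hδ0 hρ₀).le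
  have h2 : 0 ≤ stepBadC δ₀ ρ₀ := by
    rw [stepBadC]
    have hA1 : 0 ≤ stepA1 δ₀ ρ₀ := by rw [stepA1]; positivity
    have hA2 : 0 ≤ stepA2 δ₀ ρ₀ := by rw [stepA2]; positivity
    positivity
  have h3 : 0 ≤ max 1 (max (modelKA1 α δ₀ ρ₀ / stepA1 δ₀ ρ₀)
      ((modelKA2 α δ₀ ρ₀ + 3 / 8 * (lam * massBound δ₀ ρ₀)) / stepA2 δ₀ ρ₀)) :=
    le_trans zero_le_one (le_max_left _ _)
  rw [stepCK]; positivity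

section OneStep

variable {κ : ℝ≥0} {α lam : ℝ} {B₀ : Set ℂ} {ρ₀ δ₀ : ℝ} {h : ℝ≥0}
variable (hκ0 : 0 < κ) (hκ : κ ≤ 8 / 3) (hαdef : α = (6 - κ) / (2 * κ))
  (hlamdef : lam = (8 - 3 * κ) * (6 - κ) / (2 * κ))
  (hB : IsStarHull B₀) (hρ₀ : 0 < ρ₀) (hρ1 : ρ₀ ≤ 1) (hBρ : Disjoint (ball (0 : ℂ) (8 * ρ₀)) B₀)
  (hδ0 : 0 < δ₀) (hδ : δ₀ ≤ starDeriv B₀) (hh0 : 0 < h) (hh : (h : ℝ) ≤ (δ₀ * ρ₀ / 4000) ^ 2 / 32)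
  (hlamh : lam * (h * massBound δ₀ ρ₀) ≤ 1)

include hκ hαdef hlamdef in
/-- For `κ ≤ 8/3`: `α ≥ 5/8 > 0` and `λ ≥ 0`. [cite: LawlerSchrammWerner2003Restriction, §5 (5.2)–(5.3)] -/
theorem exponents_pos (hκ0 : 0 < κ) : 0 < α ∧ 0 ≤ lam := by
  have hκ' : (0 : ℝ) < κ := by exact_mod_cast hκ0
  have hκ83 : (κ : ℝ) ≤ 8 / 3 := by exact_mod_cast hκ
  constructor
  · rw [hαdef]; exact div_pos (by linarith) (by positivity)
  · rw [hlamdef]; exact div_nonneg (mul_nonneg (by linarith) (by linarith)) (by positivity)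

include hκ0 hκ hαdef hlamdef hB hρ₀ hρ1 hBρ hδ0 hδ hh0 hh hlamh in
/-- **[LSW] Prop. 5.3, one step, `0 < κ ≤ 8/3`, for any measurable version of the next value.**
If `Z : Ω → [0, 1]` is measurable and, on the good event `{σ sup_{[0,h]} |B| ≤ c₀}`, equals
`Φ′_{B′}(0)^α e^{−λJ}` (`B′ = slidHull (√κ B) B₀ h`) for some `J` with `0 ≤ J ≤ h M_m` and
`|J − h m(B₀)| ≤ h · massStepC (h + η)` — the compensator increment `∫₀ʰ m(B_s) ds` of the step is
such a `J` — then `|E[Z] − Φ′_{B₀}(0)^α| ≤ stepCK α λ δ₀ ρ₀ · h √h`.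
[cite: LawlerSchrammWerner2003Restriction, Prop. 5.3] -/
theorem abs_integral_sub_le_of_eqOn_goodK {Z : (ℝ≥0 → ℝ) → ℝ} (hZm : Measurable Z)
    (hZ01 : ∀ ω, Z ω ∈ Icc (0 : ℝ) 1)
    (hZeq : ∀ ω ∈ goodEvent δ₀ ρ₀ h, ∃ J : ℝ, 0 ≤ J ∧ J ≤ h * massBound δ₀ ρ₀ ∧
      |J - h * bubbleMass (starDeriv B₀) (starJet2 B₀ / 2) (starJet3 B₀ / 6)| ≤
        h * (massStepC δ₀ ρ₀ * (h + stepSize (stepSigma * runSup h ω) h)) ∧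
      Z ω = starDeriv (slidHull (stepDriverK κ ω) B₀ h) ^ α * Real.exp (-(lam * J))) :
    |∫ ω, Z ω ∂preWienerMeasure - starDeriv B₀ ^ α| ≤ stepCK α lam δ₀ ρ₀ * h * Real.sqrt h := by
  haveI := isProbabilityMeasure_preWienerMeasure'
  obtain ⟨hαpos, hlam0⟩ := exponents_pos hκ hαdef hlamdef hκ0
  obtain ⟨hd0, hd1, -⟩ := starDeriv_spec hB
  obtain ⟨-, -, hc2, hc3, -⟩ := starJet_spec hB hρ₀ hBρ
  obtain ⟨hc0, hc1, h4, hh1, -⟩ := step_smallness hB hρ₀ hρ1 hδ0 hδ hh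
  set d := starDeriv B₀ with hd
  set m := bubbleMass (starDeriv B₀) (starJet2 B₀ / 2) (starJet3 B₀ / 6) with hm
  obtain ⟨hM0, iM⟩ := integral_compModelK_eq_zero (κ := κ) hκ0 hd0 hαdef hlamdef (starJet2 B₀) (starJet3 B₀) h
  have hGm := measurableSet_goodEvent δ₀ ρ₀ h
  have iZ : Integrable Z preWienerMeasure :=
    (integrable_const (1 : ℝ)).mono' hZm.aestronglyMeasurable (Eventually.of_forall fun ω ↦ by
      rw [Real.norm_eq_abs, abs_of_nonneg (hZ01 ω).1]; exact (hZ01 ω).2)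
  set F' : (ℝ≥0 → ℝ) → ℝ := fun ω ↦ (Z ω - d ^ α) -
    (stepModelK α d (starJet2 B₀) (starJet3 B₀) h (stepDriverK κ ω h) - lam * h * m * d ^ α) with hF'
  have iZY : Integrable (fun ω ↦ Z ω - d ^ α) preWienerMeasure := iZ.sub (integrable_const _)
  have iF : Integrable F' preWienerMeasure := iZY.sub iM
  have hdec : ∫ ω, Z ω ∂preWienerMeasure - d ^ α = ∫ ω, F' ω ∂preWienerMeasure := by
    rw [hF', integral_sub iZY iM, integral_sub iZ (integrable_const _), integral_const, hM0]
    simp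
  rw [hdec]
  -- sizes
  have hY0 : 0 ≤ d ^ α := Real.rpow_nonneg hd0.le _
  have hY1 : d ^ α ≤ 1 := Real.rpow_le_one hd0.le hd1 hαpos.le
  have hMb : |m| ≤ massBound δ₀ ρ₀ := by
    rw [hm, massBound]; exact abs_schwarzMass_le hδ0 hρ₀ hδ hc2 hc3
  have hMM0 : 0 ≤ massBound δ₀ ρ₀ := (abs_nonneg _).trans hMb
  -- good event
  have hgood : ∀ ω ∈ goodEvent δ₀ ρ₀ h, |F' ω| ≤ compK α lam δ₀ ρ₀ *
      (h * stepSize (stepSigma * runSup h ω) h + h ^ 2 + |stepDriver ω h| ^ 3 + h * |stepDriver ω h|) := by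
    intro ω hω
    obtain ⟨J, hJ0, hJM, hJ, hZω⟩ := hZeq ω hω
    obtain ⟨hUc, hU0⟩ := continuous_stepDriverK κ ω
    have hω' : stepSigma * runSup h ω ≤ δ₀ * ρ₀ / 4000 := hω
    have hS : ∀ v : ℝ≥0, v ≤ h → |stepDriverK κ ω v| ≤ stepSigma * runSup h ω := fun v hv ↦ abs_stepDriverK_le hκ hv ω
    have hη2 : stepSize (stepSigma * runSup h ω) h ≤ 2 * (δ₀ * ρ₀ / 4000) := by
      rw [stepSize]; linarith
    have hη : stepSize (stepSigma * runSup h ω) h ≤ starDeriv B₀ * ρ₀ / 1000 := by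
      refine hη2.trans ?_
      rw [show 2 * (δ₀ * ρ₀ / 4000) = δ₀ * ρ₀ / 2000 by ring, div_le_div_iff₀ (by norm_num) (by norm_num)]
      nlinarith [mul_le_mul_of_nonneg_right hδ hρ₀.le]
    have hη1 : stepSize (stepSigma * runSup h ω) h ≤ 1 := by linarith
    have key := abs_compensatedStep_le hB hUc hU0 hh0 hS hρ₀ hBρ hη hαpos hlam0 hρ1 hδ0 hδ hη1 hh1 hlamh hJ0 hJM hJ
    have hFω : F' ω = starDeriv (slidHull (stepDriverK κ ω) B₀ h) ^ α * Real.exp (-(lam * J)) - d ^ α -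
        (stepModelK α d (starJet2 B₀) (starJet3 B₀) h (stepDriverK κ ω h) - lam * h * m * d ^ α) := by
      rw [hF']; dsimp only; rw [hZω]
    rw [hFω]
    refine key.trans (mul_le_mul_of_nonneg_left ?_ ?_)
    · have hx := abs_stepDriverK_le_abs_stepDriver hκ ω h
      have hx0 : 0 ≤ |stepDriverK κ ω h| := abs_nonneg _
      have e1 : |stepDriverK κ ω h| ^ 3 ≤ |stepDriver ω h| ^ 3 := pow_le_pow_left₀ hx0 hx 3
      have e2 : (h : ℝ) * |stepDriverK κ ω h| ≤ h * |stepDriver ω h| := mul_le_mul_of_nonneg_left hx h.coe_nonneg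
      linarith
    · exact (compK_pos hαpos hlam0 hδ0 hρ₀).le
  -- bad event (everywhere)
  obtain ⟨hA10, hA20⟩ := modelKA_nonneg hαpos.le hδ0 hρ₀
  have hbad : ∀ ω, |F' ω| ≤ 1 + modelKA1 α δ₀ ρ₀ * |stepDriver ω h| +
      (modelKA2 α δ₀ ρ₀ + 3 / 8 * (lam * massBound δ₀ ρ₀)) * (stepDriver ω h ^ 2 + 8 / 3 * h) := by
    intro ω
    have h1 : |Z ω - d ^ α| ≤ 1 := by
      rw [abs_le]; constructor <;> linarith [(hZ01 ω).1, (hZ01 ω).2]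
    have hx := abs_stepDriverK_le_abs_stepDriver hκ ω h
    have hx2 : stepDriverK κ ω h ^ 2 ≤ stepDriver ω h ^ 2 := by
      rw [← sq_abs, ← sq_abs (stepDriver ω h)]; exact pow_le_pow_left₀ (abs_nonneg _) hx 2
    have h2 := abs_stepModelK_le_all (u := h) hαpos hδ0 hρ₀ hδ hd1 hc2 hc3 (stepDriverK κ ω h)
    have h3 : |lam * h * m * d ^ α| ≤ lam * massBound δ₀ ρ₀ * h := by
      rw [abs_mul, abs_mul, abs_mul, abs_of_nonneg hlam0, abs_of_nonneg h.coe_nonneg, abs_of_nonneg hY0]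
      calc lam * h * |m| * d ^ α ≤ lam * h * massBound δ₀ ρ₀ * 1 :=
            mul_le_mul (mul_le_mul_of_nonneg_left hMb (by positivity)) hY1 hY0 (by positivity)
        _ = lam * massBound δ₀ ρ₀ * h := by ring
    have h4 := abs_sub (Z ω - d ^ α)
      (stepModelK α d (starJet2 B₀) (starJet3 B₀) h (stepDriverK κ ω h) - lam * h * m * d ^ α)
    have h5 := abs_sub (stepModelK α d (starJet2 B₀) (starJet3 B₀) h (stepDriverK κ ω h)) (lam * h * m * d ^ α)
    have e1 : modelKA1 α δ₀ ρ₀ * |stepDriverK κ ω h| ≤ modelKA1 α δ₀ ρ₀ * |stepDriver ω h| :=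
      mul_le_mul_of_nonneg_left hx hA10
    have e2 : modelKA2 α δ₀ ρ₀ * (stepDriverK κ ω h ^ 2 + 8 / 3 * h) ≤ modelKA2 α δ₀ ρ₀ * (stepDriver ω h ^ 2 + 8 / 3 * h) :=
      mul_le_mul_of_nonneg_left (by linarith) hA20
    have e3 : lam * massBound δ₀ ρ₀ * h ≤ 3 / 8 * (lam * massBound δ₀ ρ₀) * (stepDriver ω h ^ 2 + 8 / 3 * h) := by
      have : 0 ≤ lam * massBound δ₀ ρ₀ := mul_nonneg hlam0 hMM0
      nlinarith [sq_nonneg (stepDriver ω h), this]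
    have : |F' ω| = |(Z ω - d ^ α) -
        (stepModelK α d (starJet2 B₀) (starJet3 B₀) h (stepDriverK κ ω h) - lam * h * m * d ^ α)| := rfl
    linarith
  -- the two integrals
  have h1 : |∫ ω, F' ω ∂preWienerMeasure| ≤ ∫ ω, |F' ω| ∂preWienerMeasure := abs_integral_le_integral_abs
  rw [← integral_add_compl hGm iF.abs] at h1
  have hcompK : 0 < compK α lam δ₀ ρ₀ := compK_pos hαpos hlam0 hδ0 hρ₀
  have h2 := setIntegral_good_le_of_le hB hρ₀ hρ1 hδ0 hδ hh hcompK iF hgood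
  have h3 := setIntegral_bad_le_of_le hB hρ₀ hρ1 hδ0 hδ hh0 hh iF hbad
  have h4 : 25 * compK α lam δ₀ ρ₀ * h * Real.sqrt h +
      max 1 (max (modelKA1 α δ₀ ρ₀ / stepA1 δ₀ ρ₀) ((modelKA2 α δ₀ ρ₀ + 3 / 8 * (lam * massBound δ₀ ρ₀)) / stepA2 δ₀ ρ₀)) *
        stepBadC δ₀ ρ₀ * h * Real.sqrt h = stepCK α lam δ₀ ρ₀ * h * Real.sqrt h := by
    rw [stepCK]; ring
  linarith

end OneStep

end Literature.Probability.RandomPlanarGeometry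

end
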